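import Summits.QuantumFields.GaugeBoot.BootstrapInvariantCertificates
import HarnessLib

/-!
# Equivariant Gram matrices: an invariant SOS certificate is the Gram form of a positive semidefinite matrix commuting with the permutation action on the words (gauge-boot, L1/L4 supplement)

HONEST FRAMING (cell `pub-gaugeboot`, page 1 of every file): the venture produces certified bounds
on lattice expectations at stated coupling, gauge group, dimension and torus size; NOT a mass gap,
NOT a continuum limit, NOT a string tension; NOT Yang–Mills-summit-bearing (barriers
`FixedCouplingUltralocality`, `PerturbativeInvisibility`). Structural; it certifies no number.

## Content (what block-diagonalisation of the symmetry-reduced SDP rests on)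

`BootstrapInvariantCertificates`: the optimal level-`n` bound of a lattice-invariant objective has
an INVARIANT SOS ⊕ loop-equation certificate. In `certsdp` format the SOS part is a positive
semidefinite Gram matrix `Q` on the words of length `≤ n`; the lattice symmetries PERMUTE these
words. Here:

* `gramForm_comp_of_perm` — relabelling a Gram form on a permuted family re-indexes the matrix;
* ★★ `exists_equivariant_gram_of_invariant` (any configuration space, any finite family of maps
  closed under composition acting on a finite family `m` of test functions by permutations
  `m_j ∘ R_γ = m_{p_γ j}`) — an invariant element of `sosCone (span m)` is `gramForm m Q` for a
  positive semidefinite `Q` which is EQUIVARIANT: `Q (p_γ j) (p_γ l) = Q j l` (average the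
  re-indexed Gram matrices over the family);
* `wordPerm` — the permutation of the words of length `≤ n` induced by a lattice symmetry;
  ★★★ `exists_equivariant_gram_certificate_sSup_suN` — `SU(N)` on the torus, any `β`, level `n`,
  `P` lattice-invariant in the certificate domain: the OPTIMAL level-`n` bound
  `sup levelValues • 1 - P` equals `gramForm Q + ρ` with `Q` a positive semidefinite matrix on the
  words of length `≤ n` commuting with the permutation representation of the orientation-preserving
  lattice symmetry group, and `ρ` an invariant combination of loop equations — so the certificate
  may be searched block-diagonally in any symmetry-adapted basis (the isotypic decomposition itself
  is representation theory and is not formalised here).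

References: K. Gatermann, P. A. Parrilo, J. Pure Appl. Algebra 192 (2004) 95, §5 (Thm 5.3:
invariant SOS ⇒ equivariant Gram matrix ⇒ block diagonal form); V. Kazakov, Z. Zheng,
arXiv:2203.11360 §3.2. Folklore.
-/

noncomputable section

open MeasureTheory Filter Topology NormedSpace Matrix
open Literature.MathematicalPhysics.QuantumFieldTheory (LatticeRep Site Edge GaugeConfig wilsonAction
  wilsonMeasure)
open Literature.MathematicalPhysics.QuantumLattice

namespace Summit.QuantumFields.GaugeBoot

/-! ## Equivariant Gram matrices -/

section Gram

variable {ι : Type*} {G : Type*} [TopologicalSpace G] {σ : Type*} [Fintype σ] [DecidableEq σ]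
  {Γ : Type*} [Fintype Γ]

omit [DecidableEq σ] in
/-- **Relabelling a Gram form on a permuted family re-indexes the Gram matrix**:
`(Σ Q_{ij} m_i m_j) ∘ R = Σ Q_{p⁻¹ i, p⁻¹ j} m_i m_j` when `m_j ∘ R = m_{p j}`. -/
theorem gramForm_comp_of_perm (m : σ → C(ι → G, ℝ)) (R : C(ι → G, ι → G)) (p : Equiv.Perm σ)
    (hm : ∀ j, (m j).comp R = m (p j)) (Q : Matrix σ σ ℝ) :
    (gramForm m Q).comp R = gramForm m (Q.submatrix p.symm p.symm) := by
  have h1 : (gramForm m Q).comp R = ∑ i, ∑ j, Q i j • (m (p i) * m (p j)) := by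
    ext U
    simp only [gramForm, ContinuousMap.comp_apply, ContinuousMap.coe_sum, Finset.sum_apply,
      ContinuousMap.smul_apply, ContinuousMap.mul_apply, smul_eq_mul]
    refine Finset.sum_congr rfl fun i _ => Finset.sum_congr rfl fun j _ => ?_
    rw [← hm i, ← hm j]
    rfl
  rw [h1, gramForm]
  rw [← Equiv.sum_comp p (fun i => ∑ j, Q.submatrix p.symm p.symm i j • (m i * m j))]
  refine Finset.sum_congr rfl fun i _ => ?_
  rw [← Equiv.sum_comp p (fun j => Q.submatrix p.symm p.symm (p i) j • (m (p i) * m j))]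
  refine Finset.sum_congr rfl fun j _ => ?_
  simp only [Matrix.submatrix_apply, Equiv.symm_apply_apply]

omit [Fintype σ] [DecidableEq σ] in
/-- A finite sum of positive semidefinite matrices is positive semidefinite. -/
theorem posSemidef_sum {α : Type*} (s : Finset α) {Q : α → Matrix σ σ ℝ}
    (hQ : ∀ a ∈ s, (Q a).PosSemidef) : (∑ a ∈ s, Q a).PosSemidef := by
  classical
  induction s using Finset.induction_on with
  | empty => simpa using Matrix.PosSemidef.zero
  | insert a s ha ih =>
    rw [Finset.sum_insert ha]
    exact (hQ a (Finset.mem_insert_self a s)).add (ih fun b hb => hQ b (Finset.mem_insert_of_mem hb))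

/-- ★★ **Invariant SOS elements have equivariant Gram matrices.** A finite family of configuration
maps `R_γ` acts on a finite family `m` of test functions by permutations (`m_j ∘ R_γ = m_{p_γ j}`),
the permutations closed under left multiplication up to re-indexing (`p_δ p_γ = p_{e γ}`). Then
every element of `sosCone (span m)` invariant under all `R_γ` is `gramForm m Q` with `Q` positive
semidefinite and `Q (p_γ j) (p_γ l) = Q j l` for all `γ, j, l`. [cite: GatermannParrilo2004, §5] -/
theorem exists_equivariant_gram_of_invariant [Nonempty Γ] (m : σ → C(ι → G, ℝ))
    (R : Γ → C(ι → G, ι → G)) (p : Γ → Equiv.Perm σ) (hm : ∀ γ j, (m j).comp (R γ) = m (p γ j))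
    (hp : ∀ δ, ∃ e : Γ ≃ Γ, ∀ γ, p δ * p γ = p (e γ)) {x : C(ι → G, ℝ)}
    (hx : x ∈ sosCone (Submodule.span ℝ (Set.range m) : Set C(ι → G, ℝ)))
    (hinv : ∀ γ, x.comp (R γ) = x) :
    ∃ Q : Matrix σ σ ℝ, Q.PosSemidef ∧ (∀ γ j l, Q (p γ j) (p γ l) = Q j l) ∧ gramForm m Q = x := by
  obtain ⟨Q₀, hQ₀, hx₀⟩ := exists_posSemidef_of_mem_sosCone m hx
  set c : ℝ := (Fintype.card Γ : ℝ)⁻¹ with hc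
  have hc0 : 0 ≤ c := inv_nonneg.2 (Nat.cast_nonneg _)
  set Q : Matrix σ σ ℝ := c • ∑ γ, Q₀.submatrix (p γ).symm (p γ).symm with hQdef
  refine ⟨Q, ?_, fun δ j l => ?_, ?_⟩
  · exact (posSemidef_sum _ fun γ _ => hQ₀.submatrix _).smul hc0
  · obtain ⟨e, he⟩ := hp δ
    simp only [hQdef, Matrix.smul_apply, smul_eq_mul]
    congr 1
    simp only [Matrix.sum_apply, Matrix.submatrix_apply]
    refine (Fintype.sum_equiv e (fun γ => Q₀ ((p (e γ)).symm (p δ j)) ((p (e γ)).symm (p δ l)))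
      (fun γ => Q₀ ((p γ).symm (p δ j)) ((p γ).symm (p δ l))) (fun γ => rfl)).symm.trans ?_
    refine Finset.sum_congr rfl fun γ _ => ?_
    rw [← he γ]
    simp [Equiv.Perm.mul_def]
  · -- `gramForm m Q = c • Σ_γ (gramForm m Q₀) ∘ R_γ = x`
    have h1 : gramForm m Q = c • ∑ γ, gramForm m (Q₀.submatrix (p γ).symm (p γ).symm) := by
      rw [hQdef, gramForm_smul, ← gramFormₗ_apply, map_sum]
      rfl
    rw [h1]
    have h2 : ∀ γ, gramForm m (Q₀.submatrix (p γ).symm (p γ).symm) = x := fun γ => by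
      rw [← gramForm_comp_of_perm m (R γ) (p γ) (hm γ) Q₀, hx₀, hinv γ]
    simp only [h2, Finset.sum_const, Finset.card_univ, ← Nat.cast_smul_eq_nsmul ℝ, smul_smul, hc]
    rw [inv_mul_cancel₀ (Nat.cast_ne_zero.2 Fintype.card_ne_zero), one_smul]

end Gram

/-! ## `SU(N)` on the torus: the permutation of the words induced by a lattice symmetry -/

section SuN

variable {d L : ℕ} [NeZero L] (N : ℕ) (β : ℝ) (n : ℕ)

/-- The words of length `≤ n` form a finite type. -/
instance fintypeWordsUpToSuN :
    Fintype ↥(wordsUpTo (ι := Edge d L) (fundamentalLatticeRep N) n) :=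
  (wordsUpTo_finite (fundamentalLatticeRep N) n).fintype

omit [NeZero L] in
/-- Composition with the relabelling by a bijection of the links is injective on observables. -/
theorem comp_relabelCM_injective (π : Edge d L ≃ Edge d L) :
    Function.Injective fun f : C(GaugeConfig d L (Matrix.specialUnitaryGroup (Fin N) ℂ), ℝ) =>
      f.comp (relabelCM (G := Matrix.specialUnitaryGroup (Fin N) ℂ) π) := by
  intro f g h
  ext U
  have hU : relabelCM (G := Matrix.specialUnitaryGroup (Fin N) ℂ) π (U ∘ π.symm) = U := by
    funext e; simp [relabelCM_apply]
  have h' := congrArg (fun F : C(GaugeConfig d L (Matrix.specialUnitaryGroup (Fin N) ℂ), ℝ) => F (U ∘ π.symm)) h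
  simpa only [ContinuousMap.comp_apply, hU] using h'

/-- **The permutation of the words of length `≤ n` induced by a lattice symmetry** `p`:
`w ↦ w ∘ (U ↦ U ∘ e_p)` (a word goes to a word of the same length; injective, hence bijective on
the finite set). [folklore] -/
def wordPerm (p : Equiv.Perm (Fin d) × Site d L) :
    Equiv.Perm ↥(wordsUpTo (ι := Edge d L) (fundamentalLatticeRep N) n) :=
  Equiv.ofBijective
    (fun w => ⟨(w : C(GaugeConfig d L (Matrix.specialUnitaryGroup (Fin N) ℂ), ℝ)).comp
      (relabelCM (G := Matrix.specialUnitaryGroup (Fin N) ℂ) (latticeRelabel p)),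
      comp_relabelCM_mem_wordsUpTo (fundamentalLatticeRep N) _ w.2⟩)
    (Function.Injective.bijective_of_finite fun _ _ h =>
      Subtype.ext (comp_relabelCM_injective N (latticeRelabel p) (congrArg Subtype.val h)))

/-- `wordPerm` acts by relabelling. -/
theorem coe_wordPerm (p : Equiv.Perm (Fin d) × Site d L)
    (w : ↥(wordsUpTo (ι := Edge d L) (fundamentalLatticeRep N) n)) :
    ((wordPerm N n p w : ↥(wordsUpTo (ι := Edge d L) (fundamentalLatticeRep N) n)) :
        C(GaugeConfig d L (Matrix.specialUnitaryGroup (Fin N) ℂ), ℝ)) =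
      (w : C(GaugeConfig d L (Matrix.specialUnitaryGroup (Fin N) ℂ), ℝ)).comp
        (relabelCM (G := Matrix.specialUnitaryGroup (Fin N) ℂ) (latticeRelabel p)) := rfl

/-- **The induced permutations are closed under left multiplication** (re-indexed by the inner
composition law of the lattice family). -/
theorem wordPerm_mul_closed (δ : Equiv.Perm (Fin d) × Site d L) :
    ∃ e : (Equiv.Perm (Fin d) × Site d L) ≃ (Equiv.Perm (Fin d) × Site d L),
      ∀ γ, wordPerm (L := L) N n δ * wordPerm N n γ = wordPerm N n (e γ) := by
  obtain ⟨e, he⟩ := relabelCM_latticeRelabel_closed (L := L) N δ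
  refine ⟨e, fun γ => Equiv.ext fun w => Subtype.ext ?_⟩
  rw [Equiv.Perm.coe_mul, Function.comp_apply, coe_wordPerm, coe_wordPerm, coe_wordPerm,
    ContinuousMap.comp_assoc, he γ]

omit [NeZero L] in
/-- The SOS cone of the level-`n` test functions is the SOS cone of the span of the words (as a
family indexed by the finite type of words). -/
theorem sosCone_wordTruncation_eq :
    sosCone (wordTruncation (ι := Edge d L) (fundamentalLatticeRep N) n) =
      sosCone (Submodule.span ℝ (Set.range (Subtype.val :
        ↥(wordsUpTo (ι := Edge d L) (fundamentalLatticeRep N) n) →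
          C(GaugeConfig d L (Matrix.specialUnitaryGroup (Fin N) ℂ), ℝ))) : Set _) := by
  rw [Subtype.range_coe]
  rfl

/-- ★★★ **The optimal level-`n` bound of a lattice-invariant objective has an EQUIVARIANT Gram
certificate.** `SU(N)` on the torus `(ℤ/L)^d`, any real `β`, level `n`, `P` in the level-`n`
certificate domain and invariant under all translations and axis permutations:
`(sup levelValues) • 1 - P = gramForm Q + ρ` with `Q` a positive semidefinite matrix on the words of
length `≤ n` satisfying `Q (w ∘ e_p, w' ∘ e_p) = Q (w, w')` for every lattice symmetry `p`
(commuting with the permutation representation), and `ρ` an invariant combination of level-`n`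
loop equations. [cite: GatermannParrilo2004, Thm 3.3, §5] -/
theorem exists_equivariant_gram_certificate_sSup_suN
    {P : C(GaugeConfig d L (Matrix.specialUnitaryGroup (Fin N) ℂ), ℝ)}
    (hPd : P ∈ certDomainSuN (d := d) (L := L) N β n)
    (hP : ∀ p : Equiv.Perm (Fin d) × Site d L,
      P.comp (relabelCM (G := Matrix.specialUnitaryGroup (Fin N) ℂ) (latticeRelabel p)) = P) :
    ∃ Q : Matrix ↥(wordsUpTo (ι := Edge d L) (fundamentalLatticeRep N) n)
        ↥(wordsUpTo (ι := Edge d L) (fundamentalLatticeRep N) n) ℝ,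
      Q.PosSemidef ∧
      (∀ (p : Equiv.Perm (Fin d) × Site d L) (w w' : ↥(wordsUpTo (ι := Edge d L) (fundamentalLatticeRep N) n)),
          Q (wordPerm N n p w) (wordPerm N n p w') = Q w w') ∧
      ∃ ρ ∈ rowSpace (fundamentalLatticeRep N) (suExp N)
        (fun _ : Edge d L => wilsonAction (fundamentalRep (Fin N))) β
        (wordTruncation (ι := Edge d L) (fundamentalLatticeRep N) n),
        (∀ p : Equiv.Perm (Fin d) × Site d L,
          ρ.comp (relabelCM (G := Matrix.specialUnitaryGroup (Fin N) ℂ) (latticeRelabel p)) = ρ) ∧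
        gramForm Subtype.val Q + ρ = sSup (levelValuesSuN (d := d) (L := L) N β n P) •
          (1 : C(GaugeConfig d L (Matrix.specialUnitaryGroup (Fin N) ℂ), ℝ)) - P := by
  classical
  obtain ⟨σ, hσ, ρ, hρ, hσinv, hρinv, hsum⟩ := exists_invariant_certificate_sSup_suN N β n hPd hP
  rw [sosCone_wordTruncation_eq] at hσ
  obtain ⟨Q, hQ, hQeq, hQσ⟩ := exists_equivariant_gram_of_invariant
    (Subtype.val : ↥(wordsUpTo (ι := Edge d L) (fundamentalLatticeRep N) n) → _)
    (fun p => relabelCM (G := Matrix.specialUnitaryGroup (Fin N) ℂ) (latticeRelabel p))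
    (wordPerm N n) (fun p w => (coe_wordPerm N n p w).symm) (wordPerm_mul_closed N n) hσ hσinv
  exact ⟨Q, hQ, hQeq, ρ, hρ, hρinv, by rw [hQσ, hsum]⟩

end SuN

end Summit.QuantumFields.GaugeBoot

end
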